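import Summits.KontsevichZagierPeriods.Zeta5Search.Barrier.ConeGammaS7Cocycle
import Summits.KontsevichZagierPeriods.Zeta5Search.Barrier.ConeGammaRates

/-!
# ζ(5) search — BARRIER: `δ₂₈` is a class function; `γ`'s `S₇`-invariance REDUCES to the critical-value cocycle

HONEST FRAMING (cell `pub-zeta5`): systematic search; no irrationality claim unless kernel-certified. MODEL objects
under Brown–Zudilin's (28)+(30) accounting ([BZ22] = arXiv:2210.03391; (28) observed, not proved); nothing here is a
statement about `ζ(5)` or about the cone's supremum (C2 = `BarrierC2` OPEN). No number or sentence of record moves.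
Records in print UNMOVED. Prover P2 g20 (second self-selected Lean-only item, file 3/3).

* `fstIdx_lt_sndIdx`, `idxOf_fstIdx_sndIdx`, `fstIdx_sndIdx_idxOf`, `phiForm_idxOf_min_max` — table bookkeeping;
* **`h28_permAct_eq`** — `h_k(g·a) = h_{π_g k}(a)` with the EXPLICIT index map
  `π_g k = idxOf (min (g̃ i_k) (g̃ j_k)) (max (g̃ i_k) (g̃ j_k))` (`{i_k, j_k}` the pair of form `k`, `g̃ = liftPerm g`),
  and `pairIdx_injective` — `π_g` is injective: `S₇` PERMUTES the 28 forms (the tree had only the existential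
  `exists_h28_eq_permAct`);
* **`delta28_permAct`** — `δ₂₈(g·a) = δ₂₈(a)` (a 5-subset maps to a 5-subset; `permAct_permAct`, `permAct_one`);
* **`gamma_permAct_of_critShift`** — CONDITIONAL: IF the two top critical values shift by the F-entropy cocycle,
  `C₁(g·a) = C₁(a) + ΔE`, `C₀(g·a) = C₀(a) + ΔE` with `ΔE = Σ_{i∈F}[h_i(ga) log h_i(ga) − h_i(a) log h_i(a)]`
  (plain equalities as HYPOTHESES — an algebraic statement about BZ's §5 system under the hypergeometric group,
  PROVED FOR NO DIRECTION in the kernel; seat numerics: all three critical values of the record direction shift by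
  `ΔE` to 1e−8 for three tested `g`), THEN `γ(g·a) = γ(a)` — by `delta28_permAct` and `ConeGammaS7Cocycle.phi30_permAct`
  the numerator and the denominator of `γ` are then separately invariant.
So the kernel content of «`γ` is a class function» (the `S₇` reduction of `ConeSupBound` to the ordered simplex) is
EXACTLY the critical-value cocycle; nothing else. NOT here: that cocycle, anything about C2, S-E or `ζ(5)`.
-/

noncomputable section

open Set

namespace Summit.KontsevichZagierPeriods.Zeta5Search.Barrier.ConeGamma

/-! ### Table bookkeeping: `S₇` permutes the 28 forms by an explicit index map -/

/-- In the pair table the first index is the smaller one. -/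
theorem fstIdx_lt_sndIdx (k : Fin 28) : fstIdx k < sndIdx k := by revert k; decide

/-- The inverse table recovers the index. -/
theorem idxOf_fstIdx_sndIdx (k : Fin 28) : idxOf (fstIdx k) (sndIdx k) = k := by revert k; decide

/-- The table recovers an ordered pair from its index. -/
theorem fstIdx_sndIdx_idxOf {i j : Fin 8} (h : i < j) : fstIdx (idxOf i j) = i ∧ sndIdx (idxOf i j) = j := by
  have key : ∀ i j : Fin 8, i < j → fstIdx (idxOf i j) = i ∧ sndIdx (idxOf i j) = j := by decide
  exact key i j h

/-- The form at the index of the sorted pair `{p, q}` is the pair form of `(p, q)` (`p ≠ q`). -/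
theorem phiForm_idxOf_min_max (θ : Fin 8 → ℝ) {p q : Fin 8} (hpq : p ≠ q) :
    phiForm θ (idxOf (min p q) (max p q)) = pairForm θ p q := by
  rcases lt_or_gt_of_ne hpq with h | h
  · rw [min_eq_left h.le, max_eq_right h.le, ← pairForm_eq_phiForm_idxOf θ h]
  · rw [min_eq_right h.le, max_eq_left h.le, ← pairForm_eq_phiForm_idxOf θ h, pairForm_comm]

/-- **`S₇` permutes the 28 forms, explicitly**: `h_k(g·a) = h_{π_g k}(a)` with
`π_g k = idxOf (min (g̃ i_k) (g̃ j_k)) (max (g̃ i_k) (g̃ j_k))`. -/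
theorem h28_permAct_eq (a : Dir) (g : Equiv.Perm (Fin 7)) (k : Fin 28) :
    h28 (permAct g a) k = h28 a (idxOf (min (liftPerm g (fstIdx k)) (liftPerm g (sndIdx k)))
      (max (liftPerm g (fstIdx k)) (liftPerm g (sndIdx k)))) := by
  have hne : liftPerm g (fstIdx k) ≠ liftPerm g (sndIdx k) :=
    (liftPerm g).injective.ne (fstIdx_lt_sndIdx k).ne
  have h1 : h28 (permAct g a) k = phiForm (permS g (sParam a)) k := rfl
  have h2 : ∀ m, h28 a m = phiForm (sParam a) m := by
    intro m; unfold phiForm; rw [aOfS_sParam]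
  rw [h1, h2, phiForm_permS, phiForm_idxOf_min_max _ hne]

/-- **The index map `π_g` is injective.** -/
theorem pairIdx_injective (g : Equiv.Perm (Fin 7)) :
    Function.Injective fun k : Fin 28 => idxOf (min (liftPerm g (fstIdx k)) (liftPerm g (sndIdx k)))
      (max (liftPerm g (fstIdx k)) (liftPerm g (sndIdx k))) := by
  intro k k' hkk'
  dsimp only at hkk'
  set p := liftPerm g (fstIdx k)
  set q := liftPerm g (sndIdx k)
  set p' := liftPerm g (fstIdx k')
  set q' := liftPerm g (sndIdx k')
  have hne : p ≠ q := (liftPerm g).injective.ne (fstIdx_lt_sndIdx k).ne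
  have hne' : p' ≠ q' := (liftPerm g).injective.ne (fstIdx_lt_sndIdx k').ne
  have hlt : min p q < max p q := min_lt_max.mpr hne
  have hlt' : min p' q' < max p' q' := min_lt_max.mpr hne'
  obtain ⟨e1, e2⟩ := fstIdx_sndIdx_idxOf hlt
  obtain ⟨e1', e2'⟩ := fstIdx_sndIdx_idxOf hlt'
  have hmin : min p q = min p' q' := by rw [← e1, ← e1', hkk']
  have hmax : max p q = max p' q' := by rw [← e2, ← e2', hkk']
  -- the unordered pairs agree; recover the ordered table pairs
  have hcases : (p = p' ∧ q = q') ∨ (p = q' ∧ q = p') := by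
    rcases lt_or_gt_of_ne hne with h | h <;> rcases lt_or_gt_of_ne hne' with h' | h'
    · rw [min_eq_left h.le, min_eq_left h'.le] at hmin
      rw [max_eq_right h.le, max_eq_right h'.le] at hmax
      exact Or.inl ⟨hmin, hmax⟩
    · rw [min_eq_left h.le, min_eq_right h'.le] at hmin
      rw [max_eq_right h.le, max_eq_left h'.le] at hmax
      exact Or.inr ⟨hmin, hmax⟩
    · rw [min_eq_right h.le, min_eq_left h'.le] at hmin
      rw [max_eq_left h.le, max_eq_right h'.le] at hmax
      exact Or.inr ⟨hmax, hmin⟩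
    · rw [min_eq_right h.le, min_eq_right h'.le] at hmin
      rw [max_eq_left h.le, max_eq_left h'.le] at hmax
      exact Or.inl ⟨hmax, hmin⟩
  have hinj := (liftPerm g).injective
  rcases hcases with ⟨h1, h2⟩ | ⟨h1, h2⟩
  · have hf : fstIdx k = fstIdx k' := hinj h1
    have hs : sndIdx k = sndIdx k' := hinj h2
    rw [← idxOf_fstIdx_sndIdx k, ← idxOf_fstIdx_sndIdx k', hf, hs]
  · have hf : fstIdx k = sndIdx k' := hinj h1
    have hs : sndIdx k = fstIdx k' := hinj h2
    have h3 := fstIdx_lt_sndIdx k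
    have h4 := fstIdx_lt_sndIdx k'
    rw [hf, hs] at h3
    exact absurd (h3.trans h4) (lt_irrefl _)

/-! ### `δ₂₈` is a class function -/

/-- A 5-subset of the forms of `g·a` is a 5-subset of the forms of `a`: `Σ_{i∈S} h_i(g·a) ≤ δ₂₈(a)`. -/
theorem sum_h28_permAct_le_delta28 (a : Dir) (g : Equiv.Perm (Fin 7)) {S : Finset (Fin 28)} (hS : S.card = 5) :
    ∑ i ∈ S, h28 (permAct g a) i ≤ delta28 a := by
  have hinj := pairIdx_injective g
  set π : Fin 28 → Fin 28 := fun k => idxOf (min (liftPerm g (fstIdx k)) (liftPerm g (sndIdx k)))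
    (max (liftPerm g (fstIdx k)) (liftPerm g (sndIdx k))) with hπ
  calc ∑ i ∈ S, h28 (permAct g a) i = ∑ i ∈ S, h28 a (π i) :=
        Finset.sum_congr rfl fun i _ => h28_permAct_eq a g i
    _ = ∑ j ∈ S.image π, h28 a j := (Finset.sum_image fun i _ j _ h => hinj h).symm
    _ ≤ delta28 a := le_delta28 a (by rw [Finset.card_image_of_injective S hinj, hS])

/-- `δ₂₈(g·a) ≤ δ₂₈(a)`. -/
theorem delta28_permAct_le (a : Dir) (g : Equiv.Perm (Fin 7)) : delta28 (permAct g a) ≤ delta28 a :=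
  Finset.sup'_le _ _ fun _ hS => sum_h28_permAct_le_delta28 a g (Finset.mem_powersetCard.mp hS).2

/-- Composition of the action on directions: `σ·(g·a) = (gσ)·a`. -/
theorem permAct_permAct (σ g : Equiv.Perm (Fin 7)) (a : Dir) : permAct σ (permAct g a) = permAct (g * σ) a := by
  unfold permAct
  rw [sParam_aOfS, permS_permS]

/-- **`δ₂₈` is a class function**: `δ₂₈(g·a) = δ₂₈(a)` (the exponent of BZ's lcm-denominator (28) — the sum of the
five largest of the 28 forms — does not see the representative). -/
theorem delta28_permAct (a : Dir) (g : Equiv.Perm (Fin 7)) : delta28 (permAct g a) = delta28 a := by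
  refine le_antisymm (delta28_permAct_le a g) ?_
  have h := delta28_permAct_le (permAct g a) g⁻¹
  rwa [permAct_permAct, mul_inv_cancel, permAct_one] at h

/-! ### `γ` under `S₇`: reduction to the critical-value cocycle -/

/-- **`γ`'s `S₇`-invariance reduces to the critical-value cocycle.** For `a` in the closed box and `g ∈ S₇`: IF
`C₁(g·a) = C₁(a) + ΔE` and `C₀(g·a) = C₀(a) + ΔE` with `ΔE = Σ_{i∈F}[h_i(ga)·log h_i(ga) − h_i(a)·log h_i(a)]`
(HYPOTHESES — the hypergeometric-group symmetry of BZ's §5 critical values, proved for NO direction in the kernel),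
THEN `γ(g·a) = γ(a)`: with `delta28_permAct` and `phi30_permAct` both `C₁ − C₀` and `C₁ + δ₂₈ − Φ` are invariant. -/
theorem gamma_permAct_of_critShift {a : Dir} (ha : BZBox a) (g : Equiv.Perm (Fin 7))
    (hC1 : C1 (permAct g a) = C1 a
      + ∑ i ∈ FIdx, (h28 (permAct g a) i * Real.log (h28 (permAct g a) i) - h28 a i * Real.log (h28 a i)))
    (hC0 : C0 (permAct g a) = C0 a
      + ∑ i ∈ FIdx, (h28 (permAct g a) i * Real.log (h28 (permAct g a) i) - h28 a i * Real.log (h28 a i))) :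
    gamma (permAct g a) = gamma a := by
  unfold gamma
  rw [hC1, hC0, delta28_permAct, phi30_permAct ha]
  congr 1 <;> ring

/-- Under the same hypotheses the worthiness DENOMINATOR `C₁ + δ₂₈ − Φ` is a class function (the cocycles cancel). -/
theorem denom_permAct_of_critShift {a : Dir} (ha : BZBox a) (g : Equiv.Perm (Fin 7))
    (hC1 : C1 (permAct g a) = C1 a
      + ∑ i ∈ FIdx, (h28 (permAct g a) i * Real.log (h28 (permAct g a) i) - h28 a i * Real.log (h28 a i))) :
    C1 (permAct g a) + delta28 (permAct g a) - phi30 (permAct g a) = C1 a + delta28 a - phi30 a := by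
  rw [hC1, delta28_permAct, phi30_permAct ha]
  ring

end Summit.KontsevichZagierPeriods.Zeta5Search.Barrier.ConeGamma

end
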